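import Mathlib
import Literature.AlgebraicGeometry.HodgeTheory.WeilClasses
import Literature.AlgebraicGeometry.HodgeTheory.RationalHodgeClasses
import Literature.AlgebraicGeometry.Motives.AbelianVariety
import HarnessLib

/-!
# WeilClassesSurfaces

Topic `Literature/AlgebraicGeometry/HodgeTheory`. Named literature fact(s) relocated by the gate from `Summits/HodgeConjecture/HodgeConjecture/Theorems/HeckePrymWeilWeilDescending.lean`
(accept-time relocation of `[cite]`d propositions written inline in a Summits proposal; human ruling 2026-08-15).
Sources: Markman2025SurveySecant, Schoen1998HodgeWeilAddendum, vanGeemen1994HodgeAV.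

* `Literature.AlgebraicGeometry.HodgeTheory.exists_weilType_abelianSurfaces`
-/

namespace Literature.AlgebraicGeometry.HodgeTheory

open scoped Manifold
open CategoryTheory
open Literature.AlgebraicGeometry Literature.AlgebraicGeometry.HodgeTheory
open Literature.AlgebraicTopology.SingularHomology

/-- **Abelian surfaces of Weil type exist for every `K = ℚ(√-d)`** (named fact): for every `d ≥ 1`
there is a complex abelian surface `B` with an endomorphism `ψ`, `ψ ∘ ψ = -d`, and a NON-ZERO
RATIONAL class `b` of Hodge type `(1,1)` in the Weil plane `weilClassesOf B ψ 1 d = E₊ ⊔ E₋ ⊆ H²(B(ℂ); ℂ)`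
of `(B, ψ)` ("`W_{A'}` has Hodge type `(1,1)`"). Printed instance: Schoen's partner `A'` of the
product step (Compositio 114 (1998) §10, proof of the Proposition, p. 333) — `B = E × E` for the CM
elliptic curve `E = ℂ/ℤ[√-d]`, `ψ = (√-d) × (-√-d)` (so `ψ^*` has eigenvalue `i√d` on `⟨dz₁, dz̄₂⟩`
and `-i√d` on `⟨dz̄₁, dz₂⟩`, signature `(1,1)`), `b = a · dz₁ ∧ dz̄₂ + ā · dz̄₁ ∧ dz₂` a non-zero
element of the rational plane `⋀²_K H¹(B, ℚ)` (van Geemen, LNM 1594, 5.3 and Lemma 5.2 (6): abelian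
varieties of Weil type exist in every dimension for every imaginary quadratic field; Markman,
arXiv:2509.23403 §11.5 Step 2: "there exists a polarized abelian surface of Weil type `(A₂,η₂,h₂)`").
[cite: Schoen1998HodgeWeilAddendum, §10 (proof of the Proposition, p. 333)]
[cite: vanGeemen1994HodgeAV, 5.3 and Lemma 5.2 (6)] [cite: Markman2025SurveySecant, §11.5 Step 2]
[file AlgebraicGeometry/HodgeTheory/WeilClassesSurfaces] -/
def exists_weilType_abelianSurfaces : Prop :=
  ∀ d : ℕ, 0 < d → ∃ (B : Literature.AlgebraicGeometry.Motives.AbelianVariety ℂ) (ψ : B ⟶ B)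
    (b : Literature.AlgebraicGeometry.HodgeTheory.complexBetti B.X (2 * 1)),
    B.dim = 2 ∧ CategoryTheory.CategoryStruct.comp ψ ψ = -(d • CategoryTheory.CategoryStruct.id B) ∧
    b ≠ 0 ∧ Literature.AlgebraicGeometry.HodgeTheory.IsRationalClass b ∧
    Literature.AlgebraicGeometry.HodgeTheory.IsOfHodgeType (2 * 1) B.X (2 * 1) 1 1 b ∧
    b ∈ Literature.AlgebraicGeometry.HodgeTheory.weilClassesOf B ψ 1 d

/-! ### `WeilDescending` from `ProductDescent` -/

end Literature.AlgebraicGeometry.HodgeTheory
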